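import Literature.MathematicalPhysics.QuantumFieldTheory.Balaban1983to89.B4Eq220PartitionSizes
import Literature.MathematicalPhysics.QuantumFieldTheory.Balaban1983to89.B4Lemma22EtaBox
import Literature.MathematicalPhysics.QuantumFieldTheory.Balaban1983to89.B4Lemma22SupStair
import Literature.MathematicalPhysics.QuantumFieldTheory.Balaban1983to89.B4Lemma22Invertible

/-!
# [B4] (2.10) AT A FIELD `Ã ≠ 0` AND THE REDUCTION "LEMMA 2.2 (2.17) AT `Ã` ⇒ THE FACTOR BOUND (2.20)/(2.21)":
# the commutator `K_h = [h, H_k(□,Ã)]` of [Balaban1983RegularityDecay] for the COVARIANT box operator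
# `H_k(□,Ã) = −Δ^{η,N}_{Ã,□} + m² + aP_k(Ã)`, its pointwise / `L^p` / sup bounds — the orthogonal links `U(ηÃ_b)` and
# transporters `U(Ã(Γ))` cost nothing — and `‖K_hG(h·)‖_{q,p} ≤ (2(d+1)δ₁c′ + (δ₂ + aδ₃)c)` from the two members
# `‖G‖_{q,p} ≤ c`, `‖D^η_{Ã,μ}G‖_{q,p} ≤ c′` of (2.17)

statement-level skeleton of published theorems with citation tags; proofs where landed; nothing here is a claim about the Yang–Mills mass gap

CITATION HEADER.  T. Bałaban, *Regularity and decay of lattice Green's functions*, Commun. Math. Phys. **89** (1983)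
571–597, doi:10.1007/bf01214744 [Balaban1983RegularityDecay] (cell paper B4; held text
`paper:balaban1983-cmp89-regularity-decay`, journal page = PDF page + 570; pp. 575–578).  Unit `lit-balaban-p35` gen 5,
HOME `run/shared/lean/pub/lit-balaban/`, SKELETON rows **B4.Eq2.10** (`K_j`) and **B4.Eq2.18** ((2.18)–(2.22); here the
factor bound (2.20)/(2.21)) AT A FIELD `Ã ≠ 0`.  The tree had (2.10) in Leibniz form for arbitrary link variables
(`B4Commutators25to211.opK`, `fld_opK_mulVec`) and the factor bound at ZERO FIELD only (`B4Eq220CommutatorZeroBox`,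
scalar, b04 lineage; `B4Eq220PartitionSizes.eq220_hBox` for the concrete `h_j`).  This file is the FIELD version on the
`ℝ^ι`-valued carriers of the Lemma-2.2 lineage (`B4GaugeCovariance.fieldLink`/`contourTrans`/`boxWt`/`blkWt`,
`B4Lemma21Region.covDeriv`/`siteNorm`, `B4Lemma22Reduce231.supN`, `B4Lemma22LpStair.lpM`); the sequel
`B4Eq220FactorField` feeds it with the lineage's Lemma 2.2 at `Ã = A₀ + A′` (`B4Lemma22CrossSup`, `B4Lemma22SupStair`,
`B4Lemma22LpStair`, `B4Lemma22EtaBox`).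

WHAT IS PRINTED (pp. 576–578; OCR of the held text checked against the page renders).  p. 576: «We assume also that
A_b̄ = −A_b for an arbitrary bond b.» … «(K_jφ)(x) = Π_j(x)[Σ_{b∈st(x)}(∂^ηh_j)(b)(D^η_{Ã_j}φ)(b) + (Δ^ηh_j)(x)φ(x)]
− Σ_{x′∈B^k(y^k(x))}η^d(∂^ηh_j)(Γ^{(k)}_{x,y^k(x),x′})U(Ã_j(Γ^{(k)}_{x,y^k(x),x′}))φ(x′)  (2.10)» (with the factor `a_k`
of `a_kP_k` from (2.9)); p. 577: «In the sequel we will see that R is a small operator in reasonable norms because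
|∂^ηh_j| ≤ O(M⁻¹), |Δ^ηh_j| ≤ O(M⁻²)»; p. 578: «(2.20) Σ′_{ω:n≤n₀}c₁‖K_{ω₁}G_k(□_{ω₁},Ã_{ω₁})h_{ω₁}‖_∞ · … ·
‖K_{ω_n}G_k(□_{ω_n},Ã_{ω_n})h_{ω_n}‖_∞‖f‖_∞ ≤ Σ′_{ω:n≤n₀}c₁(c₂O(1)M⁻¹)ⁿ‖f‖_∞», and (2.21) with the factors
«‖K_{ω_i}G_k(□_{ω_i},Ã_{ω_i})h_{ω_i}‖_{p₁/(i−1),p₁/i}», «‖·‖_{2,2}».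

WHAT THIS MODULE PROVES (all in full; `d + 1` lattice dimensions; fine box `Π_μ[0, nM_μ)`, mesh `η = 1/n`, unit blocks
of `n^{d+1}` sites; `A` an arbitrary ANTISYMMETRIC bond function, `U = F.U` an orthogonal one-parameter flow).
* §0 `kOp` — **`K_h = hH_k(□,A) − H_k(□,A)h`** for [B4]'s weights (`B4Commutators25to211.opK` at `boxWt`, `blkWt`,
  `fieldLink F κ A`, `contourTrans`); `kOp_eq` (`= mulH h·b4Op − b4Op·mulH h`, rfl), `kOp_eq_opA` (on the `η = L^{-k}` box
  of the Lemma-2.2 lineage, with `a = a_k`: `= mulH h·opA − opA·mulH h`, rfl).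
* §1 **THE POINTWISE BOUND (2.10) AT A FIELD** `siteNorm_kOp_le`: under the sizes `HSize n M h δ₁ δ₂ δ₃` of
  `B4Eq220CommutatorZeroBox` (`|h| ≤ 1`, `|∂^ηh| ≤ δ₁`, `|Δ^{η,N}_□h| ≤ δ₂`, block oscillation `≤ δ₃`),
  `|(K_hφ)(x)| ≤ δ₁Σ_μ(|(D^η_{A,μ}φ)(x)| + |(D^η_{A,μ}φ)(x − ηe_μ)|) + δ₂|φ(x)| + aδ₃n^{−(d+1)}Σ_{x′∈B(x)}|φ(x′)|` — the three
  printed terms: bonds (`bondTerm_le`: forward bond = `(D^η_{A,μ}φ)(x)`, backward bond = an orthogonal link times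
  `(D^η_{A,μ}φ)(x − ηe_μ)`, by `B4Lemma22PertVSup.bond_fwd`/`bond_bwd` and `A_b̄ = −A_b`), Laplacian (`lapTerm_le`),
  averaging (`avgTerm_le`, `siteNorm_projKer_le`: the kernel of `P_k(A)` is a contraction supported on the block — the
  transporters are orthogonal).  No regularity or smallness of `A` enters.
* §2 **NORM BOUNDS**: `lpM_kOp_le` — `‖K_hΦ‖_p ≤ 2δ₁Σ_μ‖D^η_{A,μ}Φ‖_p + (δ₂ + aδ₃)‖Φ‖_p` for every `p ≥ 1` (Minkowski,
  shift reindexing `B4Lemma22LpStair.lpS_le_of_dirs_add`, Schur test for the block mean `lpS_blkMean_le`);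
  `supN_kOp_le` — the same in `‖·‖_∞`.
* §3 **THE REDUCTION** `eq220_field_reduction_lp` / `eq220_field_reduction_sup`: for ANY operator `G` on the box and ANY
  source functional `ν` with `‖GΨ‖_q ≤ cν(Ψ)`, `‖D^η_{A,μ}GΨ‖_q ≤ c′ν(Ψ)` (`q ∈ [1,∞)`, resp. `q = ∞`):
  `‖K_hG(hΦ)‖_q ≤ (2(d+1)δ₁c′ + (δ₂ + aδ₃)c)ν(Φ)` whenever `ν(hΦ) ≤ ν(Φ)` (`lpM_mulH_le`, `supN_mulH_le`); with
  `δ₁ = δ₃ = s/K`, `δ₂ = s/K²` this is `≤ (2(d+1)e + 1 + a)s·K⁻¹` times the member constant (`sizes_Minv_field`) — the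
  «c₂O(1)M⁻¹» of (2.20).  `B4Eq220CommutatorZeroBox.eq220_zero_box_reduction` is the scalar zero-field case.

HONEST SCOPE.  (i) One box `Π_μ[0, nM_μ)` with [B4]'s Neumann bond weights and block averaging; `A` arbitrary
antisymmetric (the print's interior cubes carry `Ã_j = A₀ + θ_jA′`, p. 575 — regularity is needed only for the Lemma-2.2
INPUT, see `B4Eq220FactorField`); the sizes of `h` are hypotheses (`HSize`; discharged for the print's `h_j` by
`B4Eq220PartitionSizes.hsize_hBox`).  (ii) Nothing of (2.12)–(2.13), (2.18)–(2.19), (2.21)–(2.22) is summed here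
(`B4RandomWalk213`, `B4LpChain221`, `B4Ineq110WalkRoute`).  One `abbrev` (`kOp`), no `Prop` fact, no `sorry`; axioms
standard.
-/

namespace Literature.MathematicalPhysics.QuantumFieldTheory.Balaban1983to89.B4Eq220CommutatorField

open Finset Matrix
open Literature.MathematicalPhysics.QuantumFieldTheory.Balaban1983to89.B4GaugeCovariance
open Literature.MathematicalPhysics.QuantumFieldTheory.Balaban1983to89.B4Commutators25to211 (mulH opK fld_opK_mulVec
  fld_mulH_mulVec)
open Literature.MathematicalPhysics.QuantumFieldTheory.Balaban1983to89.B4Reflection242 (boxDom nbrs blk mem_nbrs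
  nbrs_comm blk_mem_boxDom)
open Literature.MathematicalPhysics.QuantumFieldTheory.Balaban1983to89.B4Green242Bridge (boxNbrs boxBlk)
open Literature.MathematicalPhysics.QuantumFieldTheory.Balaban1983to89.B4BoxCov237 (uvec)
open Literature.MathematicalPhysics.QuantumFieldTheory.Balaban1983to89.B4Eq220CommutatorZeroBox (HSize mem_boxNbrs_iff
  sum_boxNbrs_le sum_ite_val card_blkClass_box)
open Literature.MathematicalPhysics.QuantumFieldTheory.Balaban1983to89.B4Lower18Regular (e1 baseEmb stairContour lsum)
open Literature.MathematicalPhysics.QuantumFieldTheory.Balaban1983to89.B4Lemma21Region (siteNorm covDeriv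
  fld_covDeriv_mulVec_of_mem fld_covDeriv_mulVec_of_not_mem)
open Literature.MathematicalPhysics.QuantumFieldTheory.Balaban1983to89.B4Lemma22Reduce231 (supN le_supN supN_le
  supN_nonneg siteNorm_nonneg siteNorm_add_le siteNorm_smul fld_add)
open Literature.MathematicalPhysics.QuantumFieldTheory.Balaban1983to89.B4Lemma22ReduceDeriv (siteNorm_flow)
open Literature.MathematicalPhysics.QuantumFieldTheory.Balaban1983to89.B4Lemma22PertVSup (bond_fwd bond_bwd
  boxWt_nonneg blkWt_nonneg contourTrans_fieldLink siteNorm_neg)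
open Literature.MathematicalPhysics.QuantumFieldTheory.Balaban1983to89.B4Lemma22LpStair (lpS lpM lpS_nonneg lpM_nonneg
  lpS_mono' lpS_add_le lpS_const_mul lpS_schur lpS_le_of_dirs_add lpM_le_of_pt)
open Literature.MathematicalPhysics.QuantumFieldTheory.Balaban1983to89.B4Lemma22ReduceZero (Box opA greenA derivA
  siteNorm_sum_le)

noncomputable section

variable {d : ℕ} {ι : Type} [Fintype ι] [DecidableEq ι]

/-! ## §0. The operator `K_h = [h, H_k(□,A)]` of (2.10) for [B4]'s covariant box operator at an arbitrary field -/

/-- **`K_h = hH_k(□,A) − H_k(□,A)h`** for [B4]'s operator `H_k(□,A) = −Δ^{η,N}_{A,□} + m² + a·n^{−(d+1)}Q_k(A)^*Q_k(A)`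
on the fine box `Π_μ[0, nM_μ)` (mesh `η = 1/n`, bond weights `boxWt`, block weights `blkWt`, link variables
`U(κA_b)`, transporters `U(A(Γ_{y,x}))` of the contour system `Γ`) and a real function `h` on the box — the operator
`K_j` of (2.10) with `h = h_j`, `□ = □_j`, `A = Ã_j` (`B4Commutators25to211.opK` at [B4]'s weights).
[cite: Balaban1983RegularityDecay, (2.10) p. 576] -/
abbrev kOp (F : OrthFlow ι) (κ : ℝ) (n : ℕ) (a m2 : ℝ) (M : Fin (d + 1) → ℕ)
    (emb : ↥(boxDom M) → ↥(boxDom fun i => n * M i))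
    (Γ : ↥(boxDom M) → ↥(boxDom fun i => n * M i) → List ↥(boxDom fun i => n * M i))
    (A : ↥(boxDom fun i => n * M i) → ↥(boxDom fun i => n * M i) → ℝ) (h : ↥(boxDom fun i => n * M i) → ℝ) :
    Matrix (↥(boxDom fun i => n * M i) × ι) (↥(boxDom fun i => n * M i) × ι) ℝ :=
  opK (boxWt n fun i => n * M i) m2 (a * ((n : ℝ) ^ (d + 1))⁻¹) (blkWt n M fun i => n * M i)
    (fieldLink F κ A) (contourTrans (fieldLink F κ A) emb Γ) h

/-- `K_h = hH − Hh` with `H = B4GaugeCovariance.b4Op` at [B4]'s box weights (definitional).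
[cite: Balaban1983RegularityDecay, (2.10) p. 576] -/
theorem kOp_eq (F : OrthFlow ι) (κ : ℝ) (n : ℕ) (a m2 : ℝ) (M : Fin (d + 1) → ℕ)
    (emb : ↥(boxDom M) → ↥(boxDom fun i => n * M i))
    (Γ : ↥(boxDom M) → ↥(boxDom fun i => n * M i) → List ↥(boxDom fun i => n * M i))
    (A : ↥(boxDom fun i => n * M i) → ↥(boxDom fun i => n * M i) → ℝ) (h : ↥(boxDom fun i => n * M i) → ℝ) :
    kOp F κ n a m2 M emb Γ A h
      = mulH (ι := ι) h * b4Op F κ (boxWt n fun i => n * M i) m2 (a * ((n : ℝ) ^ (d + 1))⁻¹)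
          (blkWt n M fun i => n * M i) emb Γ A
        - b4Op F κ (boxWt n fun i => n * M i) m2 (a * ((n : ℝ) ^ (d + 1))⁻¹) (blkWt n M fun i => n * M i) emb Γ A
          * mulH (ι := ι) h := rfl

/-- on the `η = L^{-k}` box of the Lemma-2.2 lineage: `K_h = hH_k(□,Ã) − H_k(□,Ã)h` with
`H_k(□,Ã) = B4Lemma22ReduceZero.opA` (running coefficient `a_k = B1.aSeq a L k`).
[cite: Balaban1983RegularityDecay, (2.10) p. 576, (1.6) p. 572] -/
theorem kOp_eq_opA (F : OrthFlow ι) (κ : ℝ) (ℓ k : ℕ) (a m2 : ℝ) (M : Fin (d + 1) → ℕ)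
    (emb : ↥(boxDom M) → ↥(Box d ℓ k M)) (Γ : ↥(boxDom M) → ↥(Box d ℓ k M) → List ↥(Box d ℓ k M))
    (A : ↥(Box d ℓ k M) → ↥(Box d ℓ k M) → ℝ) (h : ↥(Box d ℓ k M) → ℝ) :
    kOp F κ ((ℓ + 1) ^ k) (B1.aSeq a ((ℓ : ℝ) + 1) k) m2 M emb Γ A h
      = mulH (ι := ι) h * opA d F κ ℓ k a m2 M emb Γ A - opA d F κ ℓ k a m2 M emb Γ A * mulH (ι := ι) h := rfl

/-! ## §1. The pointwise bound: links and transporters are orthogonal, so the zero-field sizes suffice -/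

section Pointwise

variable (F : OrthFlow ι) (κ : ℝ) {n : ℕ} (a m2 : ℝ) (M : Fin (d + 1) → ℕ)
  (emb : ↥(boxDom M) → ↥(boxDom fun i => n * M i))
  (Γ : ↥(boxDom M) → ↥(boxDom fun i => n * M i) → List ↥(boxDom fun i => n * M i))
  (A : ↥(boxDom fun i => n * M i) → ↥(boxDom fun i => n * M i) → ℝ)

/-- [B4]'s bond weights are symmetric in the ordered pair. [folklore] -/
private theorem boxWt_symm (n : ℕ) (N : Fin (d + 1) → ℕ) (x y : ↥(boxDom N)) : boxWt n N x y = boxWt n N y x := by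
  unfold boxWt
  by_cases h : y.1 ∈ nbrs x.1
  · rw [if_pos h, if_pos (nbrs_comm.1 h)]
  · rw [if_neg h, if_neg (fun h' => h (nbrs_comm.1 h'))]

/-- `2·boxWt = n²·1[nearest neighbours]`. [folklore] -/
private theorem two_mul_boxWt (n : ℕ) (N : Fin (d + 1) → ℕ) (x y : ↥(boxDom N)) :
    2 * boxWt n N x y = if y.1 ∈ nbrs x.1 then (n : ℝ) ^ 2 else 0 := by
  unfold boxWt
  split_ifs <;> ring

/-- for an ANTISYMMETRIC bond function («A_b̄ = −A_b», p. 576) the link variables of the abelian flow satisfy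
`U(κA(y,x))ᵀ = U(κA(x,y))`. [cite: Balaban1983RegularityDecay, p. 576] -/
theorem fieldLink_transpose_of_antisymm {X : Type*} (A : X → X → ℝ) (hanti : ∀ x y, A y x = -A x y) (x y : X) :
    (fieldLink F κ A y x)ᵀ = fieldLink F κ A x y := by
  simp only [fieldLink]
  rw [F.transpose_eq, hanti, mul_neg, neg_neg]

/-- the transporters of the abelian flow are orthogonal: `|U(A(Γ_{y,x}))ᵀU(A(Γ_{y,x'}))v| = |v|`. [folklore] -/
private theorem siteNorm_contourTrans_transpose_mul (y : ↥(boxDom M)) (x x' : ↥(boxDom fun i => n * M i)) (v : ι → ℝ) :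
    siteNorm (((contourTrans (fieldLink F κ A) emb Γ y x)ᵀ * contourTrans (fieldLink F κ A) emb Γ y x') *ᵥ v)
      = siteNorm v := by
  rw [contourTrans_fieldLink, contourTrans_fieldLink, F.transpose_eq, ← mulVec_mulVec, siteNorm_flow, siteNorm_flow]

/-- the block kernel `Σ_y q(y,z)q(y,z')U(A(Γ_{y,z}))ᵀU(A(Γ_{y,z'}))` of `P_k(A)` is a contraction supported on the
block of `z`: `|P(z,z')v| ≤ 1[blk z' = blk z]·|v|`. [cite: Balaban1983RegularityDecay, (1.5) p. 572, (2.8) p. 576] -/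
theorem siteNorm_projKer_le (hn : 1 ≤ n) (z z' : ↥(boxDom fun i => n * M i)) (v : ι → ℝ) :
    siteNorm ((∑ y, (blkWt n M (fun i => n * M i) y z * blkWt n M (fun i => n * M i) y z')
        • ((contourTrans (fieldLink F κ A) emb Γ y z)ᵀ * contourTrans (fieldLink F κ A) emb Γ y z')) *ᵥ v)
      ≤ (if blk n z'.1 = blk n z.1 then 1 else 0) * siteNorm v := by
  rw [Matrix.sum_mulVec]
  refine (siteNorm_sum_le _ _).trans ?_
  have hterm : ∀ y, siteNorm (((blkWt n M (fun i => n * M i) y z * blkWt n M (fun i => n * M i) y z')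
      • ((contourTrans (fieldLink F κ A) emb Γ y z)ᵀ * contourTrans (fieldLink F κ A) emb Γ y z')) *ᵥ v)
      = blkWt n M (fun i => n * M i) y z * blkWt n M (fun i => n * M i) y z' * siteNorm v := by
    intro y
    rw [Matrix.smul_mulVec, siteNorm_smul, siteNorm_contourTrans_transpose_mul,
      abs_of_nonneg (mul_nonneg (blkWt_nonneg n M _ y z) (blkWt_nonneg n M _ y z'))]
  simp_rw [hterm]
  rw [← Finset.sum_mul, sum_blkWt (blk_mem_boxDom hn z.2)]

omit [DecidableEq ι] in
/-- `|u − v| ≤ |u| + |v|`. [folklore] -/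
private theorem siteNorm_sub_le (u v : ι → ℝ) : siteNorm (u - v) ≤ siteNorm u + siteNorm v := by
  rw [sub_eq_add_neg]
  exact (siteNorm_add_le u _).trans (by rw [siteNorm_neg])

/-- THE BOND TERM of (2.10), «Σ_{b∈st(x)}(∂^ηh)(b)(D^η_Ãφ)(b)»: under `|∂^ηh| ≤ δ₁` its size at `x` is at most
`δ₁Σ_μ(|(D^η_{Ã,μ}φ)(x)| + |(D^η_{Ã,μ}φ)(x − ηe_μ)|)` — the forward bond `⟨x,x+ηe_μ⟩` gives `(D^η_{Ã,μ}φ)(x)`, the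
backward bond `⟨x−ηe_μ,x⟩` gives `U·(D^η_{Ã,μ}φ)(x−ηe_μ)` with an ORTHOGONAL link `U`.
[cite: Balaban1983RegularityDecay, (2.10) p. 576, (2.5) p. 576] -/
theorem bondTerm_le (hn : 1 ≤ n) (hanti : ∀ x y, A y x = -A x y) {δ₁ δ₂ δ₃ : ℝ}
    {h : ↥(boxDom fun i => n * M i) → ℝ} (hh : HSize n M h δ₁ δ₂ δ₃)
    (Φ : ↥(boxDom fun i => n * M i) × ι → ℝ) (z : ↥(boxDom fun i => n * M i)) :
    siteNorm (∑ z', (2 * boxWt n (fun i => n * M i) z z' * (h z' - h z))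
        • (fieldLink F κ A z z' *ᵥ fld Φ z' - fld Φ z))
      ≤ δ₁ * ∑ μ, (siteNorm (fld (covDeriv n (boxDom fun i => n * M i) (fieldLink F κ A) μ *ᵥ Φ) z)
            + (if hz : z.1 - e1 μ ∈ boxDom (fun i => n * M i) then
                siteNorm (fld (covDeriv n (boxDom fun i => n * M i) (fieldLink F κ A) μ *ᵥ Φ) ⟨z.1 - e1 μ, hz⟩)
              else 0)) := by
  have hn0 : (0 : ℝ) < n := by exact_mod_cast hn
  set W := fieldLink F κ A with hWdef
  set G : ↥(boxDom fun i => n * M i) → ℝ := fun y => (n : ℝ) * siteNorm (W z y *ᵥ fld Φ y - fld Φ z) with hGdef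
  have hG0 : ∀ y, 0 ≤ G y := fun y => mul_nonneg hn0.le (siteNorm_nonneg _)
  -- each term of the star sum is `≤ 1[z' ∼ z]·δ₁·n|Wφ(z') − φ(z)|`
  have hterm : ∀ z', siteNorm ((2 * boxWt n (fun i => n * M i) z z' * (h z' - h z))
      • (W z z' *ᵥ fld Φ z' - fld Φ z)) ≤ if z'.1 ∈ nbrs z.1 then δ₁ * G z' else 0 := by
    intro z'
    rw [siteNorm_smul, two_mul_boxWt]
    by_cases hz' : z'.1 ∈ nbrs z.1
    · rw [if_pos hz', if_pos hz', hGdef]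
      have hg := hh.grad_le z z' ((mem_boxNbrs_iff).2 hz')
      rw [abs_mul, abs_of_nonneg (by positivity : (0 : ℝ) ≤ (n : ℝ) ^ 2)]
      calc (n : ℝ) ^ 2 * |h z' - h z| * siteNorm (W z z' *ᵥ fld Φ z' - fld Φ z)
          = ((n : ℝ) * |h z' - h z|) * ((n : ℝ) * siteNorm (W z z' *ᵥ fld Φ z' - fld Φ z)) := by ring
        _ ≤ δ₁ * ((n : ℝ) * siteNorm (W z z' *ᵥ fld Φ z' - fld Φ z)) :=
            mul_le_mul_of_nonneg_right hg (mul_nonneg hn0.le (siteNorm_nonneg _))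
    · rw [if_neg hz', if_neg hz']
      simp
  -- sum over the star, then cover the star by the `2(d+1)` coordinate bonds
  calc siteNorm (∑ z', (2 * boxWt n (fun i => n * M i) z z' * (h z' - h z)) • (W z z' *ᵥ fld Φ z' - fld Φ z))
      ≤ ∑ z', siteNorm ((2 * boxWt n (fun i => n * M i) z z' * (h z' - h z)) • (W z z' *ᵥ fld Φ z' - fld Φ z)) :=
        siteNorm_sum_le _ _
    _ ≤ ∑ z', (if z'.1 ∈ nbrs z.1 then δ₁ * G z' else 0) := sum_le_sum fun z' _ => hterm z'
    _ = δ₁ * ∑ z' ∈ boxNbrs (fun i => n * M i) z, G z' := by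
        rw [boxNbrs, Finset.sum_filter, Finset.mul_sum]
        exact sum_congr rfl fun z' _ => by split_ifs <;> simp
    _ ≤ δ₁ * ∑ μ : Fin (d + 1), ((∑ y : ↥(boxDom fun i => n * M i), if y.1 = z.1 + uvec μ then G y else 0)
          + ∑ y : ↥(boxDom fun i => n * M i), if y.1 = z.1 - uvec μ then G y else 0) :=
        mul_le_mul_of_nonneg_left (sum_boxNbrs_le z G hG0) hh.nonneg₁
    _ ≤ δ₁ * ∑ μ, (siteNorm (fld (covDeriv n (boxDom fun i => n * M i) W μ *ᵥ Φ) z)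
            + (if hz : z.1 - e1 μ ∈ boxDom (fun i => n * M i) then
                siteNorm (fld (covDeriv n (boxDom fun i => n * M i) W μ *ᵥ Φ) ⟨z.1 - e1 μ, hz⟩) else 0)) := by
        refine mul_le_mul_of_nonneg_left (sum_le_sum fun μ _ => add_le_add ?_ ?_) hh.nonneg₁
        · -- forward bond `⟨z, z + e_μ⟩`
          rw [sum_ite_val (boxDom fun i => n * M i) (z.1 + uvec μ) G]
          by_cases hm : z.1 + e1 μ ∈ boxDom (fun i => n * M i)
          · rw [dif_pos (show z.1 + uvec μ ∈ boxDom (fun i => n * M i) from hm), hGdef]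
            have hb := bond_fwd hn W μ Φ (z := z) (y := ⟨z.1 + e1 μ, hm⟩) rfl
            simp only []
            rw [show (⟨z.1 + uvec μ, _⟩ : ↥(boxDom fun i => n * M i)) = ⟨z.1 + e1 μ, hm⟩ from rfl, hb,
              siteNorm_smul, abs_of_nonneg (inv_nonneg.2 hn0.le), ← mul_assoc, mul_inv_cancel₀ hn0.ne', one_mul]
          · rw [dif_neg (show ¬ (z.1 + uvec μ ∈ boxDom (fun i => n * M i)) from hm)]
            exact siteNorm_nonneg _
        · -- backward bond `⟨z − e_μ, z⟩`
          rw [sum_ite_val (boxDom fun i => n * M i) (z.1 - uvec μ) G]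
          by_cases hm : z.1 - e1 μ ∈ boxDom (fun i => n * M i)
          · rw [dif_pos (show z.1 - uvec μ ∈ boxDom (fun i => n * M i) from hm), dif_pos hm, hGdef]
            have hzy : z.1 = (⟨z.1 - e1 μ, hm⟩ : ↥(boxDom fun i => n * M i)).1 + e1 μ := by
              simp only [sub_add_cancel]
            have hb := bond_bwd F κ hn A hanti μ Φ (z := z) (y := ⟨z.1 - e1 μ, hm⟩) hzy
            simp only []
            rw [show (⟨z.1 - uvec μ, _⟩ : ↥(boxDom fun i => n * M i)) = ⟨z.1 - e1 μ, hm⟩ from rfl, hWdef, hb,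
              siteNorm_neg]
            rw [show fieldLink F κ A z ⟨z.1 - e1 μ, hm⟩ = F.U (κ * A z ⟨z.1 - e1 μ, hm⟩) from rfl, siteNorm_flow,
              siteNorm_smul, abs_of_nonneg (inv_nonneg.2 hn0.le), ← mul_assoc, mul_inv_cancel₀ hn0.ne', one_mul]
          · rw [dif_neg (show ¬ (z.1 - uvec μ ∈ boxDom (fun i => n * M i)) from hm), dif_neg hm]

omit [DecidableEq ι] in
/-- THE LAPLACIAN TERM of (2.10), «(Δ^ηh)(x)φ(x)» (Neumann Laplacian of `h` on the box): size `≤ δ₂|φ(x)|`.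
[cite: Balaban1983RegularityDecay, (2.10) p. 576, (2.7) p. 576] -/
theorem lapTerm_le {δ₁ δ₂ δ₃ : ℝ} {h : ↥(boxDom fun i => n * M i) → ℝ} (hh : HSize n M h δ₁ δ₂ δ₃)
    (Φ : ↥(boxDom fun i => n * M i) × ι → ℝ) (z : ↥(boxDom fun i => n * M i)) :
    siteNorm ((∑ z', 2 * boxWt n (fun i => n * M i) z z' * (h z' - h z)) • fld Φ z) ≤ δ₂ * siteNorm (fld Φ z) := by
  rw [siteNorm_smul]
  refine mul_le_mul_of_nonneg_right ?_ (siteNorm_nonneg _)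
  have hsum : ∑ z', 2 * boxWt n (fun i => n * M i) z z' * (h z' - h z)
      = (n : ℝ) ^ 2 * ∑ z' ∈ boxNbrs (fun i => n * M i) z, (h z' - h z) := by
    rw [boxNbrs, Finset.sum_filter, Finset.mul_sum]
    refine sum_congr rfl fun z' _ => ?_
    rw [two_mul_boxWt]
    split_ifs <;> simp
  rw [hsum]
  exact hh.lap_le z

/-- THE AVERAGING TERM of (2.10), «Σ_{x'∈B^k(y^k(x))}η^d(∂^ηh)(Γ^{(k)}_{x,y^k(x),x'})U(Ã(Γ^{(k)}_{x,y^k(x),x'}))φ(x')»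
(with the coefficient `a·n^{−(d+1)}` of `aP_k`): size `≤ aδ₃·n^{−(d+1)}Σ_{x'∈B(x)}|φ(x')|` — the transporters
`U(Ã(Γ))` are ORTHOGONAL. [cite: Balaban1983RegularityDecay, (2.10) p. 576, (2.8) p. 576] -/
theorem avgTerm_le (hn : 1 ≤ n) (ha : 0 ≤ a) {δ₁ δ₂ δ₃ : ℝ} {h : ↥(boxDom fun i => n * M i) → ℝ}
    (hh : HSize n M h δ₁ δ₂ δ₃) (Φ : ↥(boxDom fun i => n * M i) × ι → ℝ) (z : ↥(boxDom fun i => n * M i)) :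
    siteNorm ((a * ((n : ℝ) ^ (d + 1))⁻¹) • ∑ z', (h z' - h z)
        • ((∑ y, (blkWt n M (fun i => n * M i) y z * blkWt n M (fun i => n * M i) y z')
            • ((contourTrans (fieldLink F κ A) emb Γ y z)ᵀ * contourTrans (fieldLink F κ A) emb Γ y z')) *ᵥ fld Φ z'))
      ≤ a * δ₃ * (((n : ℝ) ^ (d + 1))⁻¹ * ∑ z' ∈ boxBlk n (fun i => n * M i) z, siteNorm (fld Φ z')) := by
  have hN : (0 : ℝ) ≤ ((n : ℝ) ^ (d + 1))⁻¹ := inv_nonneg.2 (by positivity)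
  rw [siteNorm_smul, abs_of_nonneg (mul_nonneg ha hN)]
  have hterm : ∀ z', siteNorm ((h z' - h z)
      • ((∑ y, (blkWt n M (fun i => n * M i) y z * blkWt n M (fun i => n * M i) y z')
          • ((contourTrans (fieldLink F κ A) emb Γ y z)ᵀ * contourTrans (fieldLink F κ A) emb Γ y z')) *ᵥ fld Φ z'))
      ≤ if blk n z'.1 = blk n z.1 then δ₃ * siteNorm (fld Φ z') else 0 := by
    intro z'
    rw [siteNorm_smul]
    refine (mul_le_mul_of_nonneg_left (siteNorm_projKer_le F κ M emb Γ A hn z z' (fld Φ z')) (abs_nonneg _)).trans ?_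
    by_cases hb : blk n z'.1 = blk n z.1
    · rw [if_pos hb, if_pos hb, one_mul]
      refine mul_le_mul_of_nonneg_right ?_ (siteNorm_nonneg _)
      rw [abs_sub_comm]
      exact hh.osc_le z z' (by simp [boxBlk, hb])
    · rw [if_neg hb, if_neg hb]
      simp
  calc a * ((n : ℝ) ^ (d + 1))⁻¹ * siteNorm (∑ z', (h z' - h z)
        • ((∑ y, (blkWt n M (fun i => n * M i) y z * blkWt n M (fun i => n * M i) y z')
          • ((contourTrans (fieldLink F κ A) emb Γ y z)ᵀ * contourTrans (fieldLink F κ A) emb Γ y z')) *ᵥ fld Φ z'))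
      ≤ a * ((n : ℝ) ^ (d + 1))⁻¹ * ∑ z', (if blk n z'.1 = blk n z.1 then δ₃ * siteNorm (fld Φ z') else 0) :=
        mul_le_mul_of_nonneg_left ((siteNorm_sum_le _ _).trans (sum_le_sum fun z' _ => hterm z'))
          (mul_nonneg ha hN)
    _ = a * δ₃ * (((n : ℝ) ^ (d + 1))⁻¹ * ∑ z' ∈ boxBlk n (fun i => n * M i) z, siteNorm (fld Φ z')) := by
        rw [boxBlk, Finset.sum_filter, Finset.mul_sum, Finset.mul_sum, Finset.mul_sum]
        refine sum_congr rfl fun z' _ => ?_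
        split_ifs <;> ring

/-- **THE POINTWISE BOUND ON `K_hφ` AT AN ARBITRARY (ANTISYMMETRIC) FIELD**: under the sizes `|h| ≤ 1`, `|∂^ηh| ≤ δ₁`,
`|Δ^{η,N}_□h| ≤ δ₂`, `osc_{B(y)}h ≤ δ₃` (`B4Eq220CommutatorZeroBox.HSize`),
`|(K_hφ)(x)| ≤ δ₁Σ_μ(|(D^η_{Ã,μ}φ)(x)| + |(D^η_{Ã,μ}φ)(x−ηe_μ)|) + δ₂|φ(x)| + aδ₃·n^{−(d+1)}Σ_{x'∈B^k(x)}|φ(x')|` — the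
SAME bound as at zero field (`B4Eq220CommutatorZeroBox.abs_opK_le`), with the covariant derivative `D^η_Ã` in place of
`∂^η`: the link variables and transporters are orthogonal.  No regularity or smallness of the field is used here.
[cite: Balaban1983RegularityDecay, (2.10) p. 576; p. 577 «|∂^ηh_j| ≤ O(M⁻¹), |Δ^ηh_j| ≤ O(M⁻²)»] -/
theorem siteNorm_kOp_le (hn : 1 ≤ n) (hanti : ∀ x y, A y x = -A x y) (ha : 0 ≤ a) {δ₁ δ₂ δ₃ : ℝ}
    {h : ↥(boxDom fun i => n * M i) → ℝ} (hh : HSize n M h δ₁ δ₂ δ₃)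
    (Φ : ↥(boxDom fun i => n * M i) × ι → ℝ) (z : ↥(boxDom fun i => n * M i)) :
    siteNorm (fld (kOp F κ n a m2 M emb Γ A h *ᵥ Φ) z)
      ≤ δ₁ * ∑ μ, (siteNorm (fld (covDeriv n (boxDom fun i => n * M i) (fieldLink F κ A) μ *ᵥ Φ) z)
            + (if hz : z.1 - e1 μ ∈ boxDom (fun i => n * M i) then
                siteNorm (fld (covDeriv n (boxDom fun i => n * M i) (fieldLink F κ A) μ *ᵥ Φ) ⟨z.1 - e1 μ, hz⟩)
              else 0))
        + δ₂ * siteNorm (fld Φ z)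
        + a * δ₃ * (((n : ℝ) ^ (d + 1))⁻¹ * ∑ z' ∈ boxBlk n (fun i => n * M i) z, siteNorm (fld Φ z')) := by
  have hc : ∀ z z' : ↥(boxDom fun i => n * M i),
      boxWt n (fun i => n * M i) z z' = boxWt n (fun i => n * M i) z' z := boxWt_symm n _
  have hW : ∀ z z' : ↥(boxDom fun i => n * M i), boxWt n (fun i => n * M i) z z' ≠ 0 →
      (fieldLink F κ A z' z)ᵀ = fieldLink F κ A z z' :=
    fun z z' _ => fieldLink_transpose_of_antisymm F κ A hanti z z'
  rw [kOp, fld_opK_mulVec (ι := ι) (boxWt n fun i => n * M i) m2 (a * ((n : ℝ) ^ (d + 1))⁻¹) (blkWt n M fun i => n * M i)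
    (fieldLink F κ A) (contourTrans (fieldLink F κ A) emb Γ) hc hW h Φ z]
  have h1 := bondTerm_le (ι := ι) F κ M A hn hanti hh Φ z
  have h2 := lapTerm_le (ι := ι) M hh Φ z
  have h3 := avgTerm_le (ι := ι) F κ a M emb Γ A hn ha hh Φ z
  refine (siteNorm_sub_le _ _).trans ?_
  exact add_le_add ((siteNorm_add_le (ι := ι) _ _).trans (add_le_add h1 h2)) h3

end Pointwise

/-! ## §2. The `L^p` and sup-norm bounds on `K_h` (Minkowski, shift reindexing, Schur test on the blocks) -/

section Norms

variable (F : OrthFlow ι) (κ : ℝ) {n : ℕ} (a m2 : ℝ) (M : Fin (d + 1) → ℕ)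
  (emb : ↥(boxDom M) → ↥(boxDom fun i => n * M i))
  (Γ : ↥(boxDom M) → ↥(boxDom fun i => n * M i) → List ↥(boxDom fun i => n * M i))
  (A : ↥(boxDom fun i => n * M i) → ↥(boxDom fun i => n * M i) → ℝ)

omit [DecidableEq ι] in
/-- the block mean of `|φ|` is an `ℓ^p` contraction for every `p ≥ 1`: the kernel `n^{−(d+1)}1[blk z' = blk z]` has unit
row and column sums (every block of the box `Π_μ[0,nM_μ)` has exactly `n^{d+1}` sites) — Schur test. [folklore] -/
private theorem lpS_blkMean_le (hn : 1 ≤ n) {p : ℝ} (hp : 1 ≤ p) (Φ : ↥(boxDom fun i => n * M i) × ι → ℝ) :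
    lpS p (fun z : ↥(boxDom fun i => n * M i) =>
        ((n : ℝ) ^ (d + 1))⁻¹ * ∑ z' ∈ boxBlk n (fun i => n * M i) z, siteNorm (fld Φ z'))
      ≤ lpM p Φ := by
  have hN : (0 : ℝ) < (n : ℝ) ^ (d + 1) := by positivity
  have hk : ∀ z z' : ↥(boxDom fun i => n * M i),
      0 ≤ ((n : ℝ) ^ (d + 1))⁻¹ * (if blk n z'.1 = blk n z.1 then (1 : ℝ) else 0) := fun z z' =>
    mul_nonneg (inv_nonneg.2 hN.le) (by split_ifs <;> norm_num)
  have hrow : ∀ z : ↥(boxDom fun i => n * M i),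
      ∑ z' : ↥(boxDom fun i => n * M i),
        ((n : ℝ) ^ (d + 1))⁻¹ * (if blk n z'.1 = blk n z.1 then (1 : ℝ) else 0) ≤ 1 := by
    intro z
    rw [← Finset.mul_sum, ← Finset.sum_filter, Finset.sum_const, nsmul_eq_mul, mul_one, card_blkClass_box hn M z]
    push_cast
    rw [inv_mul_cancel₀ hN.ne']
  have hcol : ∀ z' : ↥(boxDom fun i => n * M i),
      ∑ z : ↥(boxDom fun i => n * M i),
        ((n : ℝ) ^ (d + 1))⁻¹ * (if blk n z'.1 = blk n z.1 then (1 : ℝ) else 0) ≤ 1 := by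
    intro z'
    have he : ∀ z : ↥(boxDom fun i => n * M i),
        (if blk n z'.1 = blk n z.1 then (1 : ℝ) else 0) = (if blk n z.1 = blk n z'.1 then (1 : ℝ) else 0) :=
      fun z => by simp only [eq_comm]
    simp_rw [he]
    rw [← Finset.mul_sum, ← Finset.sum_filter, Finset.sum_const, nsmul_eq_mul, mul_one, card_blkClass_box hn M z']
    push_cast
    rw [inv_mul_cancel₀ hN.ne']
  have h := lpS_schur hp (ψ := fun z : ↥(boxDom fun i => n * M i) =>
      ((n : ℝ) ^ (d + 1))⁻¹ * ∑ z' ∈ boxBlk n (fun i => n * M i) z, siteNorm (fld Φ z'))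
    (φ := fun z' => siteNorm (fld Φ z'))
    (fun z => mul_nonneg (inv_nonneg.2 hN.le) (sum_nonneg fun _ _ => siteNorm_nonneg _))
    (fun _ => siteNorm_nonneg _) hk (fun z => le_of_eq ?_) zero_le_one hrow hcol
  · simpa only [one_mul, lpM] using h
  · rw [boxBlk, Finset.sum_filter, Finset.mul_sum]
    exact sum_congr rfl fun z' _ => by split_ifs <;> simp

omit [DecidableEq ι] in
/-- the block mean of `|φ|` is bounded by `‖Φ‖_∞`. [folklore] -/
private theorem blkMean_le_supN (hn : 1 ≤ n) (Φ : ↥(boxDom fun i => n * M i) × ι → ℝ)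
    (z : ↥(boxDom fun i => n * M i)) :
    ((n : ℝ) ^ (d + 1))⁻¹ * ∑ z' ∈ boxBlk n (fun i => n * M i) z, siteNorm (fld Φ z') ≤ supN Φ := by
  have hN : (0 : ℝ) < (n : ℝ) ^ (d + 1) := by positivity
  calc ((n : ℝ) ^ (d + 1))⁻¹ * ∑ z' ∈ boxBlk n (fun i => n * M i) z, siteNorm (fld Φ z')
      ≤ ((n : ℝ) ^ (d + 1))⁻¹ * ∑ z' ∈ boxBlk n (fun i => n * M i) z, supN Φ :=
        mul_le_mul_of_nonneg_left (sum_le_sum fun z' _ => le_supN Φ z') (inv_nonneg.2 hN.le)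
    _ = supN Φ := by
        rw [Finset.sum_const, nsmul_eq_mul, boxBlk, card_blkClass_box hn M z]
        push_cast
        rw [← mul_assoc, inv_mul_cancel₀ hN.ne', one_mul]

/-- **`‖K_hΦ‖_p ≤ 2δ₁Σ_μ‖D^η_{Ã,μ}Φ‖_p + (δ₂ + aδ₃)‖Φ‖_p` FOR EVERY `p ≥ 1`** (mixed `ℓ^p` norms of the lineage,
`B4Lemma22LpStair.lpM`), at an arbitrary antisymmetric field — the `L^p` form of the p. 577 smallness «R is a small
operator in reasonable norms because |∂^ηh_j| ≤ O(M⁻¹), |Δ^ηh_j| ≤ O(M⁻²)».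
[cite: Balaban1983RegularityDecay, (2.10) p. 576, p. 577, (2.20)–(2.21) p. 578] -/
theorem lpM_kOp_le (hn : 1 ≤ n) (hanti : ∀ x y, A y x = -A x y) (ha : 0 ≤ a) {δ₁ δ₂ δ₃ : ℝ}
    {h : ↥(boxDom fun i => n * M i) → ℝ} (hh : HSize n M h δ₁ δ₂ δ₃) {p : ℝ} (hp : 1 ≤ p)
    (Φ : ↥(boxDom fun i => n * M i) × ι → ℝ) :
    lpM p (kOp F κ n a m2 M emb Γ A h *ᵥ Φ)
      ≤ δ₁ * (2 * ∑ μ, lpM p (covDeriv n (boxDom fun i => n * M i) (fieldLink F κ A) μ *ᵥ Φ))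
        + (δ₂ + a * δ₃) * lpM p Φ := by
  have hp0 : 0 < p := by linarith
  set D : Fin (d + 1) → ↥(boxDom fun i => n * M i) × ι → ℝ :=
    fun μ => covDeriv n (boxDom fun i => n * M i) (fieldLink F κ A) μ *ᵥ Φ with hD
  set AB : ↥(boxDom fun i => n * M i) → ℝ := fun z =>
    δ₁ * ∑ μ, (siteNorm (fld (D μ) z)
        + (if hz : z.1 - e1 μ ∈ boxDom (fun i => n * M i) then siteNorm (fld (D μ) ⟨z.1 - e1 μ, hz⟩) else 0))
      + δ₂ * siteNorm (fld Φ z) with hAB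
  set C : ↥(boxDom fun i => n * M i) → ℝ := fun z =>
    a * δ₃ * (((n : ℝ) ^ (d + 1))⁻¹ * ∑ z' ∈ boxBlk n (fun i => n * M i) z, siteNorm (fld Φ z')) with hC
  have hAB0 : ∀ z, 0 ≤ AB z := fun z =>
    add_nonneg (mul_nonneg hh.nonneg₁ (sum_nonneg fun μ _ => add_nonneg (siteNorm_nonneg _)
      (by split_ifs <;> first | exact siteNorm_nonneg _ | exact le_rfl))) (mul_nonneg hh.nonneg₂ (siteNorm_nonneg _))
  have hC0 : ∀ z, 0 ≤ C z := fun z => mul_nonneg (mul_nonneg ha hh.nonneg₃)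
    (mul_nonneg (inv_nonneg.2 (by positivity)) (sum_nonneg fun _ _ => siteNorm_nonneg _))
  have hpt : ∀ z, siteNorm (fld (kOp F κ n a m2 M emb Γ A h *ᵥ Φ) z) ≤ AB z + C z := fun z =>
    siteNorm_kOp_le F κ a m2 M emb Γ A hn hanti ha hh Φ z
  have h1 : lpS p AB ≤ δ₁ * (2 * ∑ μ, lpM p (D μ)) + δ₂ * lpM p Φ :=
    lpS_le_of_dirs_add hp hh.nonneg₁ hh.nonneg₂ D Φ hAB0 fun z => le_rfl
  have h2 : lpS p C ≤ a * δ₃ * lpM p Φ := by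
    rw [hC, lpS_const_mul hp0.ne' (mul_nonneg ha hh.nonneg₃)]
    exact mul_le_mul_of_nonneg_left (lpS_blkMean_le M hn hp Φ) (mul_nonneg ha hh.nonneg₃)
  calc lpM p (kOp F κ n a m2 M emb Γ A h *ᵥ Φ)
      ≤ lpS p (fun z => AB z + C z) := lpS_mono' hp0 (fun z => siteNorm_nonneg _) hpt
    _ ≤ lpS p AB + lpS p C := lpS_add_le hp _ _
    _ ≤ δ₁ * (2 * ∑ μ, lpM p (D μ)) + δ₂ * lpM p Φ + a * δ₃ * lpM p Φ := add_le_add h1 h2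
    _ = δ₁ * (2 * ∑ μ, lpM p (D μ)) + (δ₂ + a * δ₃) * lpM p Φ := by ring

/-- **`‖K_hΦ‖_∞ ≤ 2δ₁Σ_μ‖D^η_{Ã,μ}Φ‖_∞ + (δ₂ + aδ₃)‖Φ‖_∞`** (the `‖·‖_∞` of the factors of (2.20)), at an
arbitrary antisymmetric field. [cite: Balaban1983RegularityDecay, (2.10) p. 576, p. 577, (2.20) p. 578] -/
theorem supN_kOp_le (hn : 1 ≤ n) (hanti : ∀ x y, A y x = -A x y) (ha : 0 ≤ a) {δ₁ δ₂ δ₃ : ℝ}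
    {h : ↥(boxDom fun i => n * M i) → ℝ} (hh : HSize n M h δ₁ δ₂ δ₃)
    (Φ : ↥(boxDom fun i => n * M i) × ι → ℝ) :
    supN (kOp F κ n a m2 M emb Γ A h *ᵥ Φ)
      ≤ δ₁ * (2 * ∑ μ, supN (covDeriv n (boxDom fun i => n * M i) (fieldLink F κ A) μ *ᵥ Φ))
        + (δ₂ + a * δ₃) * supN Φ := by
  set D : Fin (d + 1) → ↥(boxDom fun i => n * M i) × ι → ℝ :=
    fun μ => covDeriv n (boxDom fun i => n * M i) (fieldLink F κ A) μ *ᵥ Φ with hD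
  have hS0 : 0 ≤ ∑ μ, supN (D μ) := sum_nonneg fun μ _ => supN_nonneg _
  refine supN_le (add_nonneg (mul_nonneg hh.nonneg₁ (mul_nonneg zero_le_two hS0))
    (mul_nonneg (add_nonneg hh.nonneg₂ (mul_nonneg ha hh.nonneg₃)) (supN_nonneg _))) fun z => ?_
  refine (siteNorm_kOp_le F κ a m2 M emb Γ A hn hanti ha hh Φ z).trans ?_
  have hdirs : ∑ μ, (siteNorm (fld (D μ) z)
      + (if hz : z.1 - e1 μ ∈ boxDom (fun i => n * M i) then siteNorm (fld (D μ) ⟨z.1 - e1 μ, hz⟩) else 0))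
      ≤ 2 * ∑ μ, supN (D μ) := by
    rw [two_mul, ← sum_add_distrib]
    refine sum_le_sum fun μ _ => add_le_add (le_supN _ _) ?_
    split_ifs
    · exact le_supN _ _
    · exact supN_nonneg _
  have hblk := blkMean_le_supN M hn Φ z
  have h3 : a * δ₃ * (((n : ℝ) ^ (d + 1))⁻¹ * ∑ z' ∈ boxBlk n (fun i => n * M i) z, siteNorm (fld Φ z'))
      ≤ a * δ₃ * supN Φ := mul_le_mul_of_nonneg_left hblk (mul_nonneg ha hh.nonneg₃)
  have h2 : δ₂ * siteNorm (fld Φ z) ≤ δ₂ * supN Φ := mul_le_mul_of_nonneg_left (le_supN Φ z) hh.nonneg₂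
  have h1 := mul_le_mul_of_nonneg_left hdirs hh.nonneg₁
  linarith

end Norms

/-! ## §3. THE REDUCTION "LEMMA 2.2 (2.17) AT `Ã` ⇒ THE FACTOR BOUND (2.20)/(2.21) AT `Ã`" on a box -/

section Reduction

variable (F : OrthFlow ι) (κ : ℝ) {n : ℕ} (a m2 : ℝ) (M : Fin (d + 1) → ℕ)
  (emb : ↥(boxDom M) → ↥(boxDom fun i => n * M i))
  (Γ : ↥(boxDom M) → ↥(boxDom fun i => n * M i) → List ↥(boxDom fun i => n * M i))
  (A : ↥(boxDom fun i => n * M i) → ↥(boxDom fun i => n * M i) → ℝ)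

/-- multiplication by the partition function is a contraction: `‖hΦ‖_p ≤ ‖Φ‖_p` for `|h| ≤ 1` (`p > 0`; for the
print's `h_j`, `Σ_jh_j² = 1`). [cite: Balaban1983RegularityDecay, p. 575 «Σ_j h_j² = 1», (2.20) p. 578, dictionary] -/
theorem lpM_mulH_le {X : Type*} [Fintype X] [DecidableEq X] {p : ℝ} (hp : 0 < p) {h : X → ℝ}
    (h1 : ∀ x, |h x| ≤ 1) (Φ : X × ι → ℝ) : lpM p (mulH (ι := ι) h *ᵥ Φ) ≤ lpM p Φ :=
  lpS_mono' hp (fun x => siteNorm_nonneg _) fun x => by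
    rw [fld_mulH_mulVec, siteNorm_smul]
    exact mul_le_of_le_one_left (siteNorm_nonneg _) (h1 x)

/-- multiplication by the partition function is a contraction: `‖hΦ‖_∞ ≤ ‖Φ‖_∞` for `|h| ≤ 1`.
[cite: Balaban1983RegularityDecay, p. 575 «Σ_j h_j² = 1», (2.20) p. 578, dictionary] -/
theorem supN_mulH_le {X : Type*} [Fintype X] [DecidableEq X] {h : X → ℝ} (h1 : ∀ x, |h x| ≤ 1)
    (Φ : X × ι → ℝ) : supN (mulH (ι := ι) h *ᵥ Φ) ≤ supN Φ :=
  supN_le (supN_nonneg Φ) fun x => by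
    rw [fld_mulH_mulVec, siteNorm_smul]
    exact (mul_le_of_le_one_left (siteNorm_nonneg _) (h1 x)).trans (le_supN Φ x)

/-- **THE REDUCTION "LEMMA 2.2 ⇒ THE FACTOR BOUND OF (2.20)/(2.21)" AT AN ARBITRARY ANTISYMMETRIC FIELD, TARGET
`‖·‖_q`, `q ∈ [1,∞)`.**  Let `G` be any operator on the box (in the application `G = G_k(□,Ã)`), `ν` any size
functional on the source side (in the application `‖·‖_p`, `‖·‖_{p,η}` or `‖·‖_∞`) not increased by `Φ ↦ hΦ` at the `Φ` at hand, and
suppose the two members of (2.17) hold in the form `‖GΨ‖_q ≤ c·ν(Ψ)`, `‖D^η_{Ã,μ}GΨ‖_q ≤ c′·ν(Ψ)` (all `μ`, all `Ψ`).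
THEN, for `h` of sizes `(δ₁, δ₂, δ₃)` (`HSize`: `|h| ≤ 1`, `|∂^ηh| ≤ δ₁`, `|Δ^{η,N}_□h| ≤ δ₂`, block oscillation `≤ δ₃`),
`‖K_hG(hΦ)‖_q ≤ (2(d+1)δ₁c′ + (δ₂ + aδ₃)c)·ν(Φ)` — the factor `‖K_{ω_i}G_k(□_{ω_i},Ã_{ω_i})h_{ω_i}‖_{q,p}` of
(2.20)/(2.21) bounded by `c₂·O(1)M⁻¹` once `δ₁, δ₂, δ₃ = O(M⁻¹)` (p. 577).  `B4Eq220CommutatorZeroBox.eq220_zero_box_reduction`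
is the case `Ã = 0`, scalar.
[cite: Balaban1983RegularityDecay, (2.20)–(2.21) p. 578 with (2.10) p. 576, p. 577 and Lemma 2.2 (2.17) p. 578] -/
theorem eq220_field_reduction_lp (hn : 1 ≤ n) (hanti : ∀ x y, A y x = -A x y) (ha : 0 ≤ a) {q : ℝ} (hq : 1 ≤ q)
    {ν : (↥(boxDom fun i => n * M i) × ι → ℝ) → ℝ} {c c' : ℝ} (hc : 0 ≤ c) (hc' : 0 ≤ c')
    (G : Matrix (↥(boxDom fun i => n * M i) × ι) (↥(boxDom fun i => n * M i) × ι) ℝ)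
    (hG : ∀ Ψ, lpM q (G *ᵥ Ψ) ≤ c * ν Ψ)
    (hD : ∀ (μ : Fin (d + 1)) Ψ,
      lpM q (covDeriv n (boxDom fun i => n * M i) (fieldLink F κ A) μ *ᵥ (G *ᵥ Ψ)) ≤ c' * ν Ψ)
    {δ₁ δ₂ δ₃ : ℝ} {h : ↥(boxDom fun i => n * M i) → ℝ} (hh : HSize n M h δ₁ δ₂ δ₃)
    (Φ : ↥(boxDom fun i => n * M i) × ι → ℝ) (hν : ν (mulH (ι := ι) h *ᵥ Φ) ≤ ν Φ) :
    lpM q (kOp F κ n a m2 M emb Γ A h *ᵥ (G *ᵥ (mulH (ι := ι) h *ᵥ Φ)))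
      ≤ (2 * ((d : ℝ) + 1) * δ₁ * c' + (δ₂ + a * δ₃) * c) * ν Φ := by
  have hK := lpM_kOp_le F κ a m2 M emb Γ A hn hanti ha hh hq (G *ᵥ (mulH (ι := ι) h *ᵥ Φ))
  have h0 : lpM q (G *ᵥ (mulH (ι := ι) h *ᵥ Φ)) ≤ c * ν Φ :=
    (hG _).trans (mul_le_mul_of_nonneg_left hν hc)
  have h1 : ∀ μ : Fin (d + 1), lpM q (covDeriv n (boxDom fun i => n * M i) (fieldLink F κ A) μ
      *ᵥ (G *ᵥ (mulH (ι := ι) h *ᵥ Φ))) ≤ c' * ν Φ := fun μ =>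
    (hD μ _).trans (mul_le_mul_of_nonneg_left hν hc')
  have hsum : ∑ μ : Fin (d + 1), lpM q (covDeriv n (boxDom fun i => n * M i) (fieldLink F κ A) μ
      *ᵥ (G *ᵥ (mulH (ι := ι) h *ᵥ Φ))) ≤ ((d : ℝ) + 1) * (c' * ν Φ) := by
    refine (sum_le_sum fun μ _ => h1 μ).trans ?_
    rw [sum_const, card_univ, Fintype.card_fin, nsmul_eq_mul, Nat.cast_add, Nat.cast_one]
  have hδ₁ : 0 ≤ δ₁ * 2 := by linarith [hh.nonneg₁]
  have hδ₂₃ : 0 ≤ δ₂ + a * δ₃ := add_nonneg hh.nonneg₂ (mul_nonneg ha hh.nonneg₃)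
  calc _ ≤ _ := hK
    _ ≤ δ₁ * (2 * (((d : ℝ) + 1) * (c' * ν Φ))) + (δ₂ + a * δ₃) * (c * ν Φ) :=
        add_le_add (by rw [← mul_assoc, ← mul_assoc]; exact mul_le_mul_of_nonneg_left hsum hδ₁)
          (mul_le_mul_of_nonneg_left h0 hδ₂₃)
    _ = (2 * ((d : ℝ) + 1) * δ₁ * c' + (δ₂ + a * δ₃) * c) * ν Φ := by ring

/-- **THE REDUCTION, TARGET `‖·‖_∞`** (the norm of (2.20) «‖K_{ω_i}G_k(□_{ω_i},Ã_{ω_i})h_{ω_i}‖_∞» and of the first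
factor «‖·‖_{∞,p₁}» of (2.21)): under `‖GΨ‖_∞ ≤ c·ν(Ψ)`, `‖D^η_{Ã,μ}GΨ‖_∞ ≤ c′·ν(Ψ)`,
`‖K_hG(hΦ)‖_∞ ≤ (2(d+1)δ₁c′ + (δ₂ + aδ₃)c)·ν(Φ)`.
[cite: Balaban1983RegularityDecay, (2.20)–(2.21) p. 578 with (2.10) p. 576, p. 577 and Lemma 2.2 (2.17) p. 578] -/
theorem eq220_field_reduction_sup (hn : 1 ≤ n) (hanti : ∀ x y, A y x = -A x y) (ha : 0 ≤ a)
    {ν : (↥(boxDom fun i => n * M i) × ι → ℝ) → ℝ} {c c' : ℝ} (hc : 0 ≤ c) (hc' : 0 ≤ c')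
    (G : Matrix (↥(boxDom fun i => n * M i) × ι) (↥(boxDom fun i => n * M i) × ι) ℝ)
    (hG : ∀ Ψ, supN (G *ᵥ Ψ) ≤ c * ν Ψ)
    (hD : ∀ (μ : Fin (d + 1)) Ψ,
      supN (covDeriv n (boxDom fun i => n * M i) (fieldLink F κ A) μ *ᵥ (G *ᵥ Ψ)) ≤ c' * ν Ψ)
    {δ₁ δ₂ δ₃ : ℝ} {h : ↥(boxDom fun i => n * M i) → ℝ} (hh : HSize n M h δ₁ δ₂ δ₃)
    (Φ : ↥(boxDom fun i => n * M i) × ι → ℝ) (hν : ν (mulH (ι := ι) h *ᵥ Φ) ≤ ν Φ) :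
    supN (kOp F κ n a m2 M emb Γ A h *ᵥ (G *ᵥ (mulH (ι := ι) h *ᵥ Φ)))
      ≤ (2 * ((d : ℝ) + 1) * δ₁ * c' + (δ₂ + a * δ₃) * c) * ν Φ := by
  have hK := supN_kOp_le F κ a m2 M emb Γ A hn hanti ha hh (G *ᵥ (mulH (ι := ι) h *ᵥ Φ))
  have h0 : supN (G *ᵥ (mulH (ι := ι) h *ᵥ Φ)) ≤ c * ν Φ :=
    (hG _).trans (mul_le_mul_of_nonneg_left hν hc)
  have h1 : ∀ μ : Fin (d + 1), supN (covDeriv n (boxDom fun i => n * M i) (fieldLink F κ A) μ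
      *ᵥ (G *ᵥ (mulH (ι := ι) h *ᵥ Φ))) ≤ c' * ν Φ := fun μ =>
    (hD μ _).trans (mul_le_mul_of_nonneg_left hν hc')
  have hsum : ∑ μ : Fin (d + 1), supN (covDeriv n (boxDom fun i => n * M i) (fieldLink F κ A) μ
      *ᵥ (G *ᵥ (mulH (ι := ι) h *ᵥ Φ))) ≤ ((d : ℝ) + 1) * (c' * ν Φ) := by
    refine (sum_le_sum fun μ _ => h1 μ).trans ?_
    rw [sum_const, card_univ, Fintype.card_fin, nsmul_eq_mul, Nat.cast_add, Nat.cast_one]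
  have hδ₁ : 0 ≤ δ₁ * 2 := by linarith [hh.nonneg₁]
  have hδ₂₃ : 0 ≤ δ₂ + a * δ₃ := add_nonneg hh.nonneg₂ (mul_nonneg ha hh.nonneg₃)
  calc _ ≤ _ := hK
    _ ≤ δ₁ * (2 * (((d : ℝ) + 1) * (c' * ν Φ))) + (δ₂ + a * δ₃) * (c * ν Φ) :=
        add_le_add (by rw [← mul_assoc, ← mul_assoc]; exact mul_le_mul_of_nonneg_left hsum hδ₁)
          (mul_le_mul_of_nonneg_left h0 hδ₂₃)
    _ = (2 * ((d : ℝ) + 1) * δ₁ * c' + (δ₂ + a * δ₃) * c) * ν Φ := by ring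

/-- the arithmetic of the printed sizes: `δ₁ = δ₃ = s/K`, `δ₂ = s/K²` (`K ≥ 1` the large-cube size, `s ≥ 0`) give
`2(d+1)e·δ₁ + δ₂ + aδ₃ ≤ (2(d+1)e + 1 + a)·s·K⁻¹` — the «O(1)M⁻¹» of (2.20) (`e` = the derivative-member factor, e.g.
`1 + ℓθ`). [cite: Balaban1983RegularityDecay, (2.20) p. 578 «c₂O(1)M⁻¹» with p. 577 «|∂^ηh_j| ≤ O(M⁻¹), |Δ^ηh_j| ≤ O(M⁻²)», dictionary] -/
theorem sizes_Minv_field (d : ℕ) {s Kr : ℝ} (e a : ℝ) (hK : 1 ≤ Kr) (hs : 0 ≤ s) :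
    2 * ((d : ℝ) + 1) * e * (s / Kr) + s / Kr ^ 2 + a * (s / Kr) ≤ (2 * ((d : ℝ) + 1) * e + 1 + a) * s / Kr := by
  have hKpos : 0 < Kr := lt_of_lt_of_le one_pos hK
  have h1 : s / Kr ^ 2 ≤ s / Kr := div_le_div_of_nonneg_left hs hKpos (by nlinarith)
  have h2 : (2 * ((d : ℝ) + 1) * e + 1 + a) * s / Kr
      = 2 * ((d : ℝ) + 1) * e * (s / Kr) + s / Kr + a * (s / Kr) := by ring
  rw [h2]
  linarith

end Reduction


end

end Literature.MathematicalPhysics.QuantumFieldTheory.Balaban1983to89.B4Eq220CommutatorField
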